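import Mathlib
import HarnessLib
import HarnessLib.Audit
import Summits.CriticalPhenomena.Statement
import Literature.Probability.RandomPlanarGeometry.ChordalCurveFamily
import Literature.Probability.RandomPlanarGeometry.ChordalRestrictionMarkov
import Literature.Probability.RandomPlanarGeometry.ChordalReversibility
import Literature.Probability.RandomPlanarGeometry.LoopSpaceMaps
import HarnessLib.Audit.Status.Attr

/-!
Route: SAWIsotropicAnchor

DORMANT since 2026-08-23T15:53:59Z (reconciler: no traction for 6.1 d (last activity item-evidence-added at 2026-08-17T12:42:33Z); parked, not closed — `ledger route dormant route-CriticalPhenomena-SAWIsotropicAnchor --off` to reactivat) — unstaffed, not closed; items shared with open routes are served there. `ledger route dormant <id> --off` reactivates.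

# Route SAWIsotropicAnchor — an exactly isotropic off-lattice SAW anchor needs only
rotation-invariant restriction–Markov rigidity; ℤ² joins by direction-law universality

It suffices to show X = (A) ∧ (R) ∧ (U), realising card self-avoiding-worm-anchor ("regularise by a
rotation-invariant
microscopic cutoff, not by a lattice; only dilation is left to earn; ℤ² is the four-direction member
of one tangent-law family").
The typed ANCHOR is the freely-jointed member of the card's integrated-Markov-tangent family (the
Kratky–Porod worm is its stiff
deformation, see NOT DECOMPOSED YET): planar polygonal paths with steps of FIXED length ℓ and i.i.d.
HAAR-uniform directions, HARD
non-crossing (a positive-probability, open conditioning at every length — no Varadhan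
renormalisation), grand-canonical in the number
of steps at the critical step fugacity 1/μ_fjc (μ_fjc = lim P[N-step chain is simple]^{1/N},
subadditivity), started uniformly in
the ball B(x,ℓ) and stopped in B(y,ℓ), confined to Ω̄ — the law `fjc ℓ Ω x y` inlined (`let fjc :=
…`) in every item. At each ℓ it
has EXACTLY: restriction-as-conditioning, reversibility, domain-Markov in the tip alone at step
times, invariance under ALL rigid
motions and reflections, and the scaling orbit (λ·)_* fjc ℓ Ω x y = fjc (λℓ) (λΩ) (λx) (λy); the
step length is the mesh.
(A) ANCHOR LIMIT: the critical chain has a full scaling limit P (AnchorLimitExists) and every such P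
is a chordal
restriction–Markov, reversible, similarity- and reflection-covariant family on simple
boundary-avoiding curves (AnchorAxiomsOfLimit;
rotations/reflections/translations are exact at each ℓ, dilations come free from the scaling orbit +
the full limit).
(R) RStarRot: a chordal family with exactly those axioms — FULL similarity covariance instead of the
quarter-turn — is conformally
covariant; with LSW03 (support LSW2003Characterisation, stmt-CriticalPhenomena-8230 = the Literature
theorem LawlerSchrammWerner2003, PROVED in tree as LawlerSchrammWerner2003_holds; unguarded, so no
cite-only fact enters the cone) every P D is chordal SLE_{8/3}. RStarRot is
the rotation-invariant special case of Rigidity (stmt-CriticalPhenomena-1368, route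
SAWRestrictionRigidity): `Rigidity → RStarRot`
is a two-line proof (checked, RigidityImpliesRStarRot.lean), so provers of 1368 serve both routes.
(U) DirectionLawUniversality: replacing Haar directions by the four lattice directions (the δℤ² SAW,
`SAW.law`) changes chordal
test integrals by o(1) as δ = ℓ → 0 — the card's "rotation invariance of ℤ² = tangent-softening
universality", conjunct-facing.
Lean: `AnchorLimitExists ∧ AnchorAxiomsOfLimit ∧ RStarRot ∧ DirectionLawUniversality` — decls of
this route (one-line Props in the
items). DECIDING THEOREM (rev 1, 2026-08-15): `closes : AnchorLimitExists → RStarRot →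
AnchorAxiomsOfLimit → DirectionLawUniversality →
AnchorApproxExists → LSW2003Characterisation → SAWScalingLimit` is PROVED sorry-free in the route
file (axioms
propext/Classical.choice/Quot.sound); the restated `Assembly` (rev 2) is literally its type and
closes by `closes`.

## Assembly
Pure logic plus `integral_map` — this IS the route's deciding theorem `closes` (proved in the route
file, rev 1): fix D, a, b and a
lattice approximation; AnchorApproxExists gives an admissible chain approximation (a′, b′) of the
same domain; AnchorLimitExists gives
the full limit P; AnchorAxiomsOfLimit gives restriction-Markov, reversibility, similarity +
conjugation covariance, simplicity;
RStarRot gives conformal covariance; LSW2003Characterisation (with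
IsRestrictionMarkov.isRestriction) gives
IsSLELaw (8/3) D (P D), i.e. an SLE_{8/3} curve Γ whose law is P D — no exists_isSLECurve /
IsSLECurve.map_eq guard is
needed (rev 2 dropped the guarded LSWRestrictionFact stmt-0775 from this route and restated Assembly
accordingly); DirectionLawUniversality plus the anchor
convergence (add the two Tendsto's, `sub_add_cancel`) gives TendstoLaw of the ℤ² SAW curves to Γ;
measurability is
SAW.aemeasurable_curve. This is the TransferShape shell (stmt-CriticalPhenomena-0802/0803) with Q :=
fjc.

Rationale: WHY THIS LINE. LSW04 (LawlerSchrammWerner2004SAW §3.4, Prediction 1) reduce SAW → SLE_{8/3} to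
existence + conformal covariance of the limit, and
Beffara2008Universal (arXiv:0708.3908, Prop. 4) shows why ROTATION invariance is the expensive half
on a lattice: blind rescaling
arguments leave a linear modulus that only an embedding-specific datum can pin. The card's move is
to buy rotation invariance
EXACTLY at the microscopic scale with an isotropic cutoff while keeping every identity the lattice
routes use (restriction LSW04
§3.4.5, slit-domain Markov §2.3, reversal §3.1, scaling), so that identification needs only the
rotation-invariant case R*_rot of
the restriction–Markov rigidity conjecture (card restriction-markov-rigidity / route
SAWRestrictionRigidity) — strictly weaker
than its D4 form, killing the known exotics (linear images L_*SLE_{8/3}) by hypothesis rather than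
by the quarter-turn. Areas
imported: off-lattice polymer models (freely-jointed chains with excluded volume, Baumgärtner–Binder
doi:10.1063/1.438608,
Lyklema–Kremer doi:10.1103/physrevb.31.3182: 2D off-lattice chains sit in the ν = 3/4 class),
conformal restriction
(LawlerSchrammWerner2003Restriction), weak convergence on CurveClass (AizenmanBurchard1999,
KemppainenSmirnov2017). What it does
that prior routes do not: SAWRestrictionRigidity attacks ℤ² directly and must prove R* with a
quarter-turn only; SAWHexUniversality /
SAWQuantumGravity / SAWEdwardsStrongCoupling anchor on integrability, random geometry or weak
coupling; this line anchors on
SYMMETRY with hard avoidance, the flat twin of card poincare-chain-exact-conformal-covariance-v2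
(hyperbolic unit-step chain),
and recasts ℤ² rotation invariance as a universality statement inside one family of direction laws
(Haar ↔ ℤ/4).

RANKED CRUXES. #2 AnchorLimitExists (crux) — the critical freely-jointed non-crossing chain has a
FULL scaling limit: there is a chordal family P such that for every Dobrushin domain D and every
admissible endpoint approximation (a′(ℓ) → a, b′(ℓ) → b, the law eventually a probability measure)
the laws fjc ℓ D a′(ℓ) b′(ℓ) converge in law on CurveClass ℂ to P D as ℓ → 0+ (card V2; the limit is
NOT identified here). [deps: AnchorApproxExists] [difficulty: open-problem] (why it might fail: no
off-lattice toolbox: eventual tightness needs an annulus-crossing bound at x_c unknown even on ℤ²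
(cf. stmt-CriticalPhenomena-1372), and uniqueness of subsequential limits needs a full-filter
avoidance-ratio limit; no unfolding/bridge decomposition with real-valued spans is in print.)
[LawlerSchrammWerner2004SAW, KemppainenSmirnov2017, AizenmanBurchard1999, DuminilCopinHammond2013,
doi:10.1103/physrevb.31.3182]
#3 RStarRot (crux) — R*_rot (card V3; rotation-invariant special case of Rigidity
stmt-CriticalPhenomena-1368): a chordal curve family on Dobrushin domains that is chordal, has the
restriction-coupled domain Markov property (ChordalFamily.IsRestrictionMarkov), is reversible
(ChordalFamily.IsReversible), is covariant under ALL similarities z ↦ cz + w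
(ChordalFamily.IsSimilarityCovariant) and under complex conjugation, and is carried by simple curves
meeting ∂D only at the marked points, is conformally covariant
(ChordalFamily.IsConformallyCovariant) — hence SLE_{8/3} by LSW03. [difficulty: open-problem] (why
it might fail: no technique known without a conformal structure: the Markov axiom relates laws in
non-similar slit domains and nothing yet forces the only consistent assignment D ↦ P_D to be the
conformal one; a.e.-slack in the kernel may admit choice-built exotic families.)
[LawlerSchrammWerner2003Restriction, Beffara2008Universal, Werner2007, Schramm2000,
arXiv:math/0307353]
#4 AnchorAxiomsOfLimit (crux) — given that every Dobrushin domain admits an admissible chain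
approximation (the content of AnchorApproxExists, put as a hypothesis so that no unconstrained value
P D can refute it), every chordal family P that is the full limit of the critical chain (as in
AnchorLimitExists, for all domains and all admissible approximations) satisfies the hypotheses of
RStarRot: restriction-coupled Markov, reversibility, full similarity covariance, conjugation
covariance, simplicity and boundary avoidance (card V1/V2: restriction, reversal, rotations,
reflections, translations are EXACT identities of fjc at each ℓ; dilations via the exact scaling
orbit and the full limit; Markov in the tip is exact at step times). [deps: AnchorLimitExists,
AnchorApproxExists] [difficulty: L] (why it might fail: restriction passage needs null
boundary-touching of the limit; Markov passage needs stability of the chain's limits in slit domains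
perturbed near the tip (mid-step hitting); simplicity/no-macroscopic-self-touching of an off-lattice
critical polymer has no Kesten-pattern or DCH13-type proof.) [LawlerSchrammWerner2004SAW,
Werner2007, DuminilCopinHammond2013, KennedyLawler2013]
#5 DirectionLawUniversality (crux) — direction-law universality Haar ↔ ℤ/4 (card V4,
conjunct-facing): for every Dobrushin domain, every lattice endpoint approximation
(SAW.IsEndpointApprox) and every admissible chain approximation of the same marked points, the
chordal test integrals of the critical δℤ² SAW law (pushed to CurveClass) and of fjc δ D a′(δ) b′(δ)
differ by o(1) as δ → 0+. [difficulty: open-problem] (why it might fail: genuine universality, at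
the ℤ² end equivalent to rotation invariance of the lattice limit; along any interpolating direction
law a perturbation rotates the whole future frame (continuum pivot), so fluctuation–response needs
decorrelation of shape from frame noise — no technology.) [Beffara2008Universal,
LawlerSchrammWerner2004SAW, MadrasSlade1993, KennedyLawler2013, Kennedy2004]
#9 AnchorApproxExists (support) — every Dobrushin domain admits an admissible chain approximation:
interior points a′(ℓ) → a, b′(ℓ) → b with fjc ℓ D a′(ℓ) b′(ℓ) a probability measure for all small ℓ
(diagonal choice of interior points with room ≫ ℓ; needs μ_fjc > 0, measurability of the
configuration maps, and the CONFINEMENT LEMMA: in a bounded domain the critical grand-canonical mass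
Σ_N μ_fjc^{-N} Z_N(Ω,ℓ) is finite — packing N ≫ area/ℓ² unit segments without crossing costs
superexponentially; lattice analogue: confinement strictly lowers the growth rate, MadrasSlade1993
§8.2 after Hammersley–Whittington 1985). [difficulty: M] [MadrasSlade1993,
LawlerSchrammWerner2004SAW]
#9 LSW2003Characterisation (support) — Lawler–Schramm–Werner 2003, Conformal restriction: the
chordal case (arXiv:math/0209343: p. 5 result 2 with Prop. 3.3, Thm 6.1, Cor. 8.6) transposed to
chordal families on Dobrushin domains, UNGUARDED: a chordal family that is conformally covariant
(ChordalFamily.IsConformallyCovariant, inlined), has the two-sided restriction property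
(ChordalFamily.IsRestriction, inlined) and is carried by simple curves meeting ∂D only at the marked
points is, in every Dobrushin domain, the chordal SLE_{8/3} law (IsSLELaw (8/3)); verbatim the
Literature theorem `LawlerSchrammWerner2003` (ConformalRestriction.lean), proved in tree
(`LawlerSchrammWerner2003_holds`, ConformalRestrictionHolds.lean) — closes in one line after `import
Literature.Probability.RandomPlanarGeometry.ConformalRestrictionHolds`. Replaces in this route (rev
2) the exists_isSLECurve-guarded shared item LSWRestrictionFact stmt-CriticalPhenomena-0775, which
dragged the cite-only fact exists_isSLECurve into the cone; the restated Assembly (rev 2) is the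
type of the proved deciding theorem `closes` and closes by it. [difficulty: provable-now]
[LawlerSchrammWerner2003Restriction]

TWO-LAYER PLAN. Foreseen glued splits (k ≤ 3, depth 1; nothing filed now): AnchorLimitExists ⇐
AnchorEventualTight → AnchorAvoidanceCocycleLimit
(full-filter limit of fjc-probabilities of {range ⊆ D̄′}, the off-lattice twin of
stmt-CriticalPhenomena-1369; with the shared
AvoidanceDeterminesLaw stmt-1373 it makes subsequential limits unique) → AnchorLimitExists.
AnchorAxiomsOfLimit ⇐ ExactIdentitiesPass
(restriction, reversal, rotations/reflections/translations exact at each ℓ; dilations by the orbit)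
→ MarkovPassage → SimpleBoundaryAvoiding
→ AnchorAxiomsOfLimit. DirectionLawUniversality ⇐ StiffnessHomotopy (one-parameter direction laws
ρ_t from ℤ/4 to Haar, or von Mises
bending weights e^{κ cos Δθ} — the Kratky–Porod worm of the card is the κ → ∞, step → 0 corner) →
FluctuationResponseDecay →
DirectionLawUniversality. RStarRot ⇐ SimilarityOnlyClassification (hull-avoidance functional under
similarities) → ExoticExclusion → RStarRot.

KILL CRITERIA. ¬RStarRot by an exactly isotropic, reflection-symmetric restriction–Markov reversible
family on simple curves that is not conformally
covariant closes the route `refuted:RStarRot` (and refutes Rigidity stmt-1368 a fortiori — major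
negative knowledge for the whole
rigidity programme). ¬DirectionLawUniversality with a genuine witness (Haar and ℤ/4 limits differ)
means the ℤ² limit is not rotation
invariant: the conjunct SAWScalingLimit itself dies, not just this route. ¬AnchorLimitExists /
¬AnchorAxiomsOfLimit by a JUNK witness
(degenerate normalisation, an admissible approximation hugging a wild prime end) ⇒ restate with the
repaired admissibility clause, not a
close; by a genuine witness (non-simple or boundary-touching limit of the off-lattice chain) ⇒ close
refuted and record "hard non-crossing
of zero-width segments is not in the SAW class" as a barrier. ¬AnchorApproxExists (infinite critical
mass in a bounded domain) ⇒ pivot to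
the hard-disc (bead) chain, same items. Rigidity (1368) proved ⇒ RStarRot closes for free;
SAWScalingLimit proved elsewhere moots all.

NOT DECOMPOSED YET. Eventual tightness and RSW-type annulus bounds for the chain at x_c (child of
AnchorLimitExists; never the refuted all-δ form
stmt-CriticalPhenomena-0772 — every ℓ/δ-quantifier here is along 𝓝[>] 0); μ_fjc > 0 and Fekete;
measurability/continuity of the
configuration-to-CurveClass maps (so that `Measure.map` is not junk); the confinement lemma; null
boundary-touching; the Kratky–Porod
WORM itself (C¹ member, tangent = circular Brownian motion, persistence length = mesh: needs a
Wiener-functional definition and the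
extra tip-tangent-amnesia step the freely-jointed member does not need) — deliberately deferred to
the stiffness axis of the
universality split; Carathéodory/prime-end bookkeeping (admissibility is quantified, never "closest
point"); the negative side ¬RStarRot.

CHEAPEST FALSIFIER. (i) Monte Carlo, cheapest and decisive for the anchor: pivot + reptation
sampling of the critical non-crossing freely-jointed chain in a
disc / half-disc at two step lengths (μ_fjc from the same code by survival-rate extrapolation):
Schramm's left-passage law and the
boundary-bump avoidance Φ′(a)^{5/8}Φ′(b)^{5/8} (Kennedy2002/Kennedy2004 did exactly this on the
square lattice; no off-lattice test
found) — disagreement beyond finite-ℓ drift kills (A); agreement but a ℤ²-vs-chain discrepancy in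
the same domain kills (U).
(ii) Analytic junk check a refuter can run in an hour: is the critical grand-canonical mass of the
chain finite in the unit disc
(confinement lemma)? If not, every fjc-law is the zero measure and the anchor must be re-normalised
(pivot, see KILL CRITERIA).
Not run here (compute-free hub, plancard unit); recommended first refuter action.

NUMBERS. κ = 8/3; restriction exponent 5/8; ν = 3/4, γ = 43/32 (Nienhuis; LawlerSchrammWerner2004SAW
Predictions 2–5) expected for every
member of the direction-law family incl. off-lattice chains (Lyklema–Kremer 1985, 2D off-lattice
MC); μ(ℤ²) ∈ [2.6, 2.7]
(Literature fact LawlerSchrammWerner2004SAW_connectiveConstant_bounds) i.e. survival rate μ/3 ≈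
0.879 per non-reversing step,
against μ_fjc ∈ [1/6, 1] for the chain (cone bound; no value in print for zero-width non-crossing
steps); items at open: 7
(4 cruxes, 2 supports, 1 assembly).

DEFINITION REQUESTS. FreelyJointedSAW.law (topic Literature/Probability/RandomPlanarGeometry): the
inlined `fjc ℓ Ω x y` as a named def with API —
exact scaling/rotation/reflection/translation/reversal identities, restriction-as-conditioning,
`IsProbabilityMeasure ↔ 0 < mass < ∞`,
μ_fjc > 0 — so the four long signatures shrink and ExactIdentitiesPass becomes provable-now; later
FreelyJointedSAW.lawStiff κ
(von Mises bending weight) for the stiffness homotopy, and WormLaw (Kratky–Porod, persistence ℓ) for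
the card's C¹ member.
No cite facts: LSW03 enters as the proved Literature theorem LawlerSchrammWerner2003_holds (item
LSW2003Characterisation, stmt-8230); after rev 2 the item cone has 0 unproved named facts.

Novelty: Searches (2026-08-15): `lit search --hybrid "off-lattice self-avoiding walk two dimensions scaling
limit SLE 8/3 freely jointed
chain"` (12 held docs: MadrasSlade1993 pp.14–38/293 off-lattice MC only, Guttmann polygons book, den
Hollander, Lawler2005 — no
SLE statement for an off-lattice chain); `lit vsearch` of the anchor's description (10, same books);
`lit galaxy search "off-lattice
self-avoiding walk" --star all` (1 row: Madras–Slade); crossref ×3 ("off-lattice SAW 2D SLE Monte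
Carlo freely jointed excluded
volume": Baumgärtner–Binder 1979 doi:10.1063/1.438608, Wittkop et al. 1996; "SLE test off-lattice
SAW continuum": Kennedy2002,
Kennedy2004, Kennedy 2015 doi:10.1007/s10955-015-1271-4, Gherardi 2009/2010 — all lattice; "2D
off-lattice SAW ν = 3/4
universality": Lyklema–Kremer doi:10.1103/physrevb.31.3182, KennedyLawler2013);
arXiv/zbMATH/searchd: HTTP 429 / 0 / rc 75
(flagged); `lit frontier CriticalPhenomena --since 2020` (30 rows; only arXiv:2310.17299
sub-ballisticity is adjacent); plus the
card's audited searches (refuter-novelty-audit-…-11-0: Hsu–Paul–Binder arXiv:1111.3231/1208.3617,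
LSW03, LSW04, Beffara).
Nearest prior art found: Kennedy2002/Kennedy2004 (MC agreement of the SQUARE-lattice SAW with
SLE_{8/3}); LawlerSchrammWerner2004SAW
(restriction/Markov/reversal identities, conformal covariance left open);
LawlerSchrammWerner2003Restriction (identification under
conformal invariance); Beffara2008Universal (why exact isotropy is worth buying); Baumgärtner–Binde  [refs: 10.1063/1.438608, 10.1007/s10955-015-1271-4, 10.1103/physrevb.31.3182, 2310.17299, 1111.3231, 1612.04169, doi:10.1063/1.438608, doi:10.1007/s10955-015-1271-4, doi:10.1103/physrevb.31.3182, MadrasSlade1993, Lawler2005, Kennedy2002, Kennedy2004, KennedyLawler2013]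

Barriers (technique_class: continuum-anchor isotropic-regularisation, rigidity): - technique_class: continuum-anchor isotropic-regularisation, rigidity
- Literature.Barriers.CriticalPhenomena.EmbeddingModulusUniqueness: evaded for (A)+(R) by
construction — the anchor has no embedding modulus (Haar directions: exactly isotropic and
reflection-symmetric at every ℓ), so Beffara's linear-image freedom is excluded by RStarRot's
HYPOTHESIS; for ℤ² it reappears honestly as crux DirectionLawUniversality, a universality statement,
which is where the barrier says the embedding datum must enter.
- Literature.Barriers.CriticalPhenomena.ScaleCovarianceNotMoebius: RStarRot is a symmetry-upgrade
principle and could fail the same way; it does not rest on Euclidean + scale data alone but on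
two-sided restriction, restriction-coupled Markov and reversibility of a planar CURVE family
(outside the barrier's correlation-function class); an isotropic non-conformal restriction–Markov
family is the route's first kill criterion.
- Literature.Barriers.CriticalPhenomena.PlanarEdwardsModelDiffusive: not met — no Gibbs tilt of
Brownian motion or random walk by a self-intersection energy; avoidance is a HARD constraint of
positive probability at each length on piecewise-linear paths, taken at the critical step fugacity,
where absolute continuity w.r.t. the free flight is lost (P[simple] = μ_fjc^{N+o(N)} → 0).
- Literature.Barriers.CriticalPhenomena.SupercriticalSAWSpaceFilling: every law sits AT 1/μ_fjc
(resp. x_c); no item is open in the fugacity; the continuum shadow (mass escaping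

History (route lifecycle, newest last):
- 2026-08-15T16:13:04Z · rev 2: restated Assembly (stmt-CriticalPhenomena-7302) — route-repair (cone): restate Assembly without the exists_isSLECurve → IsSLECurve.map_eq → LSWRestrictionFact guards (superseded by the proved deciding theorem c (planner-rbadge-CriticalPhenomena-SAWIsotropicA-e213f66a-g4-0)
- 2026-08-15T16:13:04Z · rev 2: dropped LSWRestrictionFact — route-repair (cone): restate Assembly without the exists_isSLECurve → IsSLECurve.map_eq → LSWRestrictionFact guards (superseded by the proved deciding theorem c (planner-rbadge-CriticalPhenomena-SAWIsotropicA-e213f66a-g4-0)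
- 2026-08-23T15:53:59Z · DORMANT — reconciler: no traction for 6.1 d (last activity item-evidence-added at 2026-08-17T12:42:33Z); parked, not closed — `ledger route dormant route-CriticalPhenomen (operator:999:463069)

sub-problem: SAWScalingLimit · status: dormant · opened planner-plancard-CriticalPhenomena-SAWScaling-dbed78ef-0 2026-08-15T12:07:21Z · rev 3 · ledger route-CriticalPhenomena-SAWIsotropicAnchor
GENERATED by the gate from the ledger (D-0016/17). Provers cite these decls: `theorem foo : Summit.CriticalPhenomena.SAWScalingLimit.Theses.SAWIsotropicAnchor.<Decl> := …` in Summits/CriticalPhenomena/SAWScalingLimit/Theorems/<Name>.lean.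
-/

namespace Summit.CriticalPhenomena.SAWScalingLimit.Theses.SAWIsotropicAnchor

open scoped BigOperators Topology Manifold Classical MeasureTheory ProbabilityTheory Matrix InnerProductSpace ComplexConjugate ContinuousMap
open Filter Set Function TopologicalSpace MeasureTheory

attribute [summit_statement] _root_.SAWScalingLimit

/-- item stmt-CriticalPhenomena-7297 · crux · rank 2 · open · by planner
why it might fail: no off-lattice toolbox: eventual tightness needs an annulus-crossing bound at x_c unknown even on ℤ² (cf. stmt-CriticalPhenomena-1372), and uniqueness of subsequential limits needs a full-filter avoidance-ratio limit; no unfolding/bridge decomposition with real-valued spans is in print.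
sources: LawlerSchrammWerner2004SAW, KemppainenSmirnov2017, AizenmanBurchard1999, DuminilCopinHammond2013, doi:10.1103/physrevb.31.3182
[crux] the critical freely-jointed non-crossing chain has a FULL scaling limit: there is a chordal
family P such that for every Dobrushin domain D and every admissible endpoint approximation (a′(ℓ) →
a, b′(ℓ) → b, the law eventually a probability measure) the laws fjc ℓ D a′(ℓ) b′(ℓ) converge in law
on CurveClass ℂ to P D as ℓ → 0+ (card V2; the limit is NOT identified here). [deps:
AnchorApproxExists] [difficulty: open-problem] -/
@[route_item "route-CriticalPhenomena-SAWIsotropicAnchor", crux]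
def AnchorLimitExists : Prop :=
  let fjc : ℝ → Set ℂ → ℂ → ℂ → MeasureTheory.Measure (Literature.Probability.RandomPlanarGeometry.CurveClass ℂ) := fun ℓ Ω x y => (let S : (N : ℕ) → (Fin N → ℝ) → Fin (N + 1) → ℂ := fun N θ k => ∑ j : Fin N, if (j : ℕ) < (k : ℕ) then Complex.exp (Complex.I * (θ j : ℂ)) else 0; let C : (N : ℕ) → (Fin (N + 1) → ℂ) → Literature.Probability.RandomPlanarGeometry.CurveClass ℂ := fun _ v => Literature.Probability.RandomPlanarGeometry.CurveClass.mk ⟨Literature.Probability.LatticeModels.polyline (List.ofFn v)⟩; let Z : ℕ → ℝ := fun N => ((MeasureTheory.volume : MeasureTheory.Measure (Fin N → ℝ)) {θ | (∀ j, θ j ∈ Set.Ico (0 : ℝ) (2 * Real.pi)) ∧ C N (S N θ) ∈ Literature.Probability.RandomPlanarGeometry.CurveClass.simple}).toReal / (2 * Real.pi) ^ N; let μ : ℝ := ⨅ N : ℕ, Z (N + 1) ^ (1 / ((N : ℝ) + 1)); let V : (N : ℕ) → ℂ × (Fin N → ℝ) → Literature.Probability.RandomPlanarGeometry.CurveClass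 ℂ := fun N p => C N (fun k => p.1 + (ℓ : ℂ) * S N p.2 k); let E : Set (Literature.Probability.RandomPlanarGeometry.CurveClass ℂ) := {c | c ∈ Literature.Probability.RandomPlanarGeometry.CurveClass.simple ∧ c.range ⊆ closure Ω ∧ c.target ∈ Metric.ball y ℓ}; let W : MeasureTheory.Measure (Literature.Probability.RandomPlanarGeometry.CurveClass ℂ) := MeasureTheory.Measure.sum fun N : ℕ => ENNReal.ofReal ((μ⁻¹ / (2 * Real.pi)) ^ N) • ((((MeasureTheory.volume.restrict (Metric.ball x ℓ)).prod (MeasureTheory.volume.restrict (Set.univ.pi fun _ : Fin N => Set.Ico (0 : ℝ) (2 * Real.pi)))).restrict (V N ⁻¹' E)).map (V N)); (W Set.univ)⁻¹ • W); ∃ P : Literature.Probability.RandomPlanarGeometry.ChordalFamily, P.IsChordal ∧ ∀ (D : Literature.Probability.RandomPlanarGeometry.DobrushinDomain) (a' b' : ℝ → ℂ), (Filter.Tendsto a' (nhdsWithin 0 (Set.Ioi 0)) (nhds (D.pt 0)) ∧ Filter.Tendsto b' (nhdsWithin 0 (Set.Ioi 0)) (nhds (D.pt 1)) ∧ ∀ᶠ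 ℓ in nhdsWithin 0 (Set.Ioi 0), MeasureTheory.IsProbabilityMeasure (fjc ℓ D.carrier (a' ℓ) (b' ℓ))) → Literature.Probability.RandomPlanarGeometry.TendstoLaw (fun (_ : ℝ) (c : Literature.Probability.RandomPlanarGeometry.CurveClass ℂ) => c) (fun ℓ => fjc ℓ D.carrier (a' ℓ) (b' ℓ)) id (P D)

/-- item stmt-CriticalPhenomena-7298 · crux · rank 3 · open · by planner
why it might fail: no technique known without a conformal structure: the Markov axiom relates laws in non-similar slit domains and nothing yet forces the only consistent assignment D ↦ P_D to be the conformal one; a.e.-slack in the kernel may admit choice-built exotic families.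
sources: LawlerSchrammWerner2003Restriction, Beffara2008Universal, Werner2007, Schramm2000, arXiv:math/0307353
[crux] R*_rot (card V3; rotation-invariant special case of Rigidity stmt-CriticalPhenomena-1368): a
chordal curve family on Dobrushin domains that is chordal, has the restriction-coupled domain Markov
property (ChordalFamily.IsRestrictionMarkov), is reversible (ChordalFamily.IsReversible), is
covariant under ALL similarities z ↦ cz + w (ChordalFamily.IsSimilarityCovariant) and under complex
conjugation, and is carried by simple curves meeting ∂D only at the marked points, is conformally
covariant (ChordalFamily.IsConformallyCovariant) — hence SLE_{8/3} by LSW03. [difficulty: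
open-problem] -/
@[route_item "route-CriticalPhenomena-SAWIsotropicAnchor", crux]
def RStarRot : Prop :=
  ∀ P : Literature.Probability.RandomPlanarGeometry.ChordalFamily, P.IsChordal → P.IsRestrictionMarkov → P.IsReversible → P.IsSimilarityCovariant → (∀ D : Literature.Probability.RandomPlanarGeometry.DobrushinDomain, P (D.map Complex.conjLIE.toHomeomorph) = (P D).map (Literature.Probability.RandomPlanarGeometry.CurveClass.map (Complex.conjLIE.toHomeomorph : C(ℂ, ℂ)))) → (∀ D : Literature.Probability.RandomPlanarGeometry.DobrushinDomain, ∀ᵐ γ ∂(P D), γ ∈ Literature.Probability.RandomPlanarGeometry.CurveClass.simple ∧ γ.range ∩ frontier D.carrier ⊆ {D.pt 0, D.pt 1}) → P.IsConformallyCovariant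

/-- item stmt-CriticalPhenomena-7299 · crux · rank 4 · open · by planner
why it might fail: restriction passage needs null boundary-touching of the limit; Markov passage needs stability of the chain's limits in slit domains perturbed near the tip (mid-step hitting); simplicity/no-macroscopic-self-touching of an off-lattice critical polymer has no Kesten-pattern or DCH13-type proof.
sources: LawlerSchrammWerner2004SAW, Werner2007, DuminilCopinHammond2013, KennedyLawler2013
[crux] given that every Dobrushin domain admits an admissible chain approximation (the content of
AnchorApproxExists, put as a hypothesis so that no unconstrained value P D can refute it), every
chordal family P that is the full limit of the critical chain (as in AnchorLimitExists, for all
domains and all admissible approximations) satisfies the hypotheses of RStarRot: restriction-coupled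
Markov, reversibility, full similarity covariance, conjugation covariance, simplicity and boundary
avoidance (card V1/V2: restriction, reversal, rotations, reflections, translations are EXACT
identities of fjc at each ℓ; dilations via the exact scaling orbit and the full limit; Markov in the
tip is exact at step times). [deps: AnchorLimitExists, AnchorApproxExists] [difficulty: L] -/
@[route_item "route-CriticalPhenomena-SAWIsotropicAnchor", crux]
def AnchorAxiomsOfLimit : Prop :=
  let fjc : ℝ → Set ℂ → ℂ → ℂ → MeasureTheory.Measure (Literature.Probability.RandomPlanarGeometry.CurveClass ℂ) := fun ℓ Ω x y => (let S : (N : ℕ) → (Fin N → ℝ) → Fin (N + 1) → ℂ := fun N θ k => ∑ j : Fin N, if (j : ℕ) < (k : ℕ) then Complex.exp (Complex.I * (θ j : ℂ)) else 0; let C : (N : ℕ) → (Fin (N + 1) → ℂ) → Literature.Probability.RandomPlanarGeometry.CurveClass ℂ := fun _ v => Literature.Probability.RandomPlanarGeometry.CurveClass.mk ⟨Literature.Probability.LatticeModels.polyline (List.ofFn v)⟩; let Z : ℕ → ℝ := fun N => ((MeasureTheory.volume : MeasureTheory.Measure (Fin N → ℝ)) {θ | (∀ j, θ j ∈ Set.Ico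 (0 : ℝ) (2 * Real.pi)) ∧ C N (S N θ) ∈ Literature.Probability.RandomPlanarGeometry.CurveClass.simple}).toReal / (2 * Real.pi) ^ N; let μ : ℝ := ⨅ N : ℕ, Z (N + 1) ^ (1 / ((N : ℝ) + 1)); let V : (N : ℕ) → ℂ × (Fin N → ℝ) → Literature.Probability.RandomPlanarGeometry.CurveClass ℂ := fun N p => C N (fun k => p.1 + (ℓ : ℂ) * S N p.2 k); let E : Set (Literature.Probability.RandomPlanarGeometry.CurveClass ℂ) := {c | c ∈ Literature.Probability.RandomPlanarGeometry.CurveClass.simple ∧ c.range ⊆ closure Ω ∧ c.target ∈ Metric.ball y ℓ}; let W : MeasureTheory.Measure (Literature.Probability.RandomPlanarGeometry.CurveClass ℂ) := MeasureTheory.Measure.sum fun N : ℕ => ENNReal.ofReal ((μ⁻¹ / (2 * Real.pi)) ^ N) • ((((MeasureTheory.volume.restrict (Metric.ball x ℓ)).prod (MeasureTheory.volume.restrict (Set.univ.pi fun _ : Fin N => Set.Ico (0 : ℝ) (2 * Real.pi)))).restrict (V N ⁻¹' E)).map (V N)); (W Set.univ)⁻¹ • W); ∀ P : Literature.Probability.RandomPlanarGeometry.ChordalFamily,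 P.IsChordal → (∀ D : Literature.Probability.RandomPlanarGeometry.DobrushinDomain, ∃ a' b' : ℝ → ℂ, (Filter.Tendsto a' (nhdsWithin 0 (Set.Ioi 0)) (nhds (D.pt 0)) ∧ Filter.Tendsto b' (nhdsWithin 0 (Set.Ioi 0)) (nhds (D.pt 1)) ∧ ∀ᶠ ℓ in nhdsWithin 0 (Set.Ioi 0), MeasureTheory.IsProbabilityMeasure (fjc ℓ D.carrier (a' ℓ) (b' ℓ)))) → (∀ (D : Literature.Probability.RandomPlanarGeometry.DobrushinDomain) (a' b' : ℝ → ℂ), (Filter.Tendsto a' (nhdsWithin 0 (Set.Ioi 0)) (nhds (D.pt 0)) ∧ Filter.Tendsto b' (nhdsWithin 0 (Set.Ioi 0)) (nhds (D.pt 1)) ∧ ∀ᶠ ℓ in nhdsWithin 0 (Set.Ioi 0), MeasureTheory.IsProbabilityMeasure (fjc ℓ D.carrier (a' ℓ) (b' ℓ))) → Literature.Probability.RandomPlanarGeometry.TendstoLaw (fun (_ : ℝ) (c : Literature.Probability.RandomPlanarGeometry.CurveClass ℂ) => c) (fun ℓ => fjc ℓ D.carrier (a' ℓ) (b' ℓ))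 id (P D)) → P.IsRestrictionMarkov ∧ P.IsReversible ∧ P.IsSimilarityCovariant ∧ (∀ D : Literature.Probability.RandomPlanarGeometry.DobrushinDomain, P (D.map Complex.conjLIE.toHomeomorph) = (P D).map (Literature.Probability.RandomPlanarGeometry.CurveClass.map (Complex.conjLIE.toHomeomorph : C(ℂ, ℂ)))) ∧ (∀ D : Literature.Probability.RandomPlanarGeometry.DobrushinDomain, ∀ᵐ γ ∂(P D), γ ∈ Literature.Probability.RandomPlanarGeometry.CurveClass.simple ∧ γ.range ∩ frontier D.carrier ⊆ {D.pt 0, D.pt 1})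

/-- item stmt-CriticalPhenomena-7300 · crux · rank 5 · open · by planner
why it might fail: genuine universality, at the ℤ² end equivalent to rotation invariance of the lattice limit; along any interpolating direction law a perturbation rotates the whole future frame (continuum pivot), so fluctuation–response needs decorrelation of shape from frame noise — no technology.
sources: Beffara2008Universal, LawlerSchrammWerner2004SAW, MadrasSlade1993, KennedyLawler2013, Kennedy2004
[crux] direction-law universality Haar ↔ ℤ/4 (card V4, conjunct-facing): for every Dobrushin domain,
every lattice endpoint approximation (SAW.IsEndpointApprox) and every admissible chain approximation
of the same marked points, the chordal test integrals of the critical δℤ² SAW law (pushed to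
CurveClass) and of fjc δ D a′(δ) b′(δ) differ by o(1) as δ → 0+. [difficulty: open-problem] -/
@[route_item "route-CriticalPhenomena-SAWIsotropicAnchor", crux]
def DirectionLawUniversality : Prop :=
  let fjc : ℝ → Set ℂ → ℂ → ℂ → MeasureTheory.Measure (Literature.Probability.RandomPlanarGeometry.CurveClass ℂ) := fun ℓ Ω x y => (let S : (N : ℕ) → (Fin N → ℝ) → Fin (N + 1) → ℂ := fun N θ k => ∑ j : Fin N, if (j : ℕ) < (k : ℕ) then Complex.exp (Complex.I * (θ j : ℂ)) else 0; let C : (N : ℕ) → (Fin (N + 1) → ℂ) → Literature.Probability.RandomPlanarGeometry.CurveClass ℂ := fun _ v => Literature.Probability.RandomPlanarGeometry.CurveClass.mk ⟨Literature.Probability.LatticeModels.polyline (List.ofFn v)⟩; let Z : ℕ → ℝ := fun N => ((MeasureTheory.volume : MeasureTheory.Measure (Fin N → ℝ)) {θ | (∀ j, θ j ∈ Set.Ico (0 : ℝ) (2 * Real.pi)) ∧ C N (S N θ) ∈ Literature.Probability.RandomPlanarGeometry.CurveClass.simple}).toReal / (2 * Real.pi) ^ N; let μ : ℝ := ⨅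 N : ℕ, Z (N + 1) ^ (1 / ((N : ℝ) + 1)); let V : (N : ℕ) → ℂ × (Fin N → ℝ) → Literature.Probability.RandomPlanarGeometry.CurveClass ℂ := fun N p => C N (fun k => p.1 + (ℓ : ℂ) * S N p.2 k); let E : Set (Literature.Probability.RandomPlanarGeometry.CurveClass ℂ) := {c | c ∈ Literature.Probability.RandomPlanarGeometry.CurveClass.simple ∧ c.range ⊆ closure Ω ∧ c.target ∈ Metric.ball y ℓ}; let W : MeasureTheory.Measure (Literature.Probability.RandomPlanarGeometry.CurveClass ℂ) := MeasureTheory.Measure.sum fun N : ℕ => ENNReal.ofReal ((μ⁻¹ / (2 * Real.pi)) ^ N) • ((((MeasureTheory.volume.restrict (Metric.ball x ℓ)).prod (MeasureTheory.volume.restrict (Set.univ.pi fun _ : Fin N => Set.Ico (0 : ℝ) (2 * Real.pi)))).restrict (V N ⁻¹' E)).map (V N)); (W Set.univ)⁻¹ • W); ∀ (D : Literature.Probability.RandomPlanarGeometry.DobrushinDomain) (a b : ℝ → Literature.Probability.LatticeModels.Site 2) (a' b' : ℝ → ℂ), Literature.Probability.RandomPlanarGeometry.SAW.IsEndpointApprox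 D a b → (Filter.Tendsto a' (nhdsWithin 0 (Set.Ioi 0)) (nhds (D.pt 0)) ∧ Filter.Tendsto b' (nhdsWithin 0 (Set.Ioi 0)) (nhds (D.pt 1)) ∧ ∀ᶠ ℓ in nhdsWithin 0 (Set.Ioi 0), MeasureTheory.IsProbabilityMeasure (fjc ℓ D.carrier (a' ℓ) (b' ℓ))) → ∀ f : BoundedContinuousFunction (Literature.Probability.RandomPlanarGeometry.CurveClass ℂ) ℝ, Filter.Tendsto (fun δ => (∫ γ, f γ.curve ∂(Literature.Probability.RandomPlanarGeometry.SAW.law D.carrier δ (a δ) (b δ))) - ∫ c, f c ∂(fjc δ D.carrier (a' δ) (b' δ))) (nhdsWithin 0 (Set.Ioi 0)) (nhds 0)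

/-- item stmt-CriticalPhenomena-7301 · support · rank 9 · open · by planner
sources: MadrasSlade1993, LawlerSchrammWerner2004SAW
[support] every Dobrushin domain admits an admissible chain approximation: interior points a′(ℓ) →
a, b′(ℓ) → b with fjc ℓ D a′(ℓ) b′(ℓ) a probability measure for all small ℓ (diagonal choice of
interior points with room ≫ ℓ; needs μ_fjc > 0, measurability of the configuration maps, and the
CONFINEMENT LEMMA: in a bounded domain the critical grand-canonical mass Σ_N μ_fjc^{-N} Z_N(Ω,ℓ) is
finite — packing N ≫ area/ℓ² unit segments without crossing costs superexponentially; lattice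
analogue: confinement strictly lowers the growth rate, MadrasSlade1993 §8.2 after
Hammersley–Whittington 1985). [difficulty: M] -/
@[route_item "route-CriticalPhenomena-SAWIsotropicAnchor", crux]
def AnchorApproxExists : Prop :=
  let fjc : ℝ → Set ℂ → ℂ → ℂ → MeasureTheory.Measure (Literature.Probability.RandomPlanarGeometry.CurveClass ℂ) := fun ℓ Ω x y => (let S : (N : ℕ) → (Fin N → ℝ) → Fin (N + 1) → ℂ := fun N θ k => ∑ j : Fin N, if (j : ℕ) < (k : ℕ) then Complex.exp (Complex.I * (θ j : ℂ)) else 0; let C : (N : ℕ) → (Fin (N + 1) → ℂ) → Literature.Probability.RandomPlanarGeometry.CurveClass ℂ := fun _ v => Literature.Probability.RandomPlanarGeometry.CurveClass.mk ⟨Literature.Probability.LatticeModels.polyline (List.ofFn v)⟩; let Z : ℕ → ℝ := fun N => ((MeasureTheory.volume : MeasureTheory.Measure (Fin N → ℝ)) {θ | (∀ j, θ j ∈ Set.Ico (0 : ℝ) (2 * Real.pi)) ∧ C N (S N θ) ∈ Literature.Probability.RandomPlanarGeometry.CurveClass.simple}).toReal / (2 * Real.pi) ^ N; let μ : ℝ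 := ⨅ N : ℕ, Z (N + 1) ^ (1 / ((N : ℝ) + 1)); let V : (N : ℕ) → ℂ × (Fin N → ℝ) → Literature.Probability.RandomPlanarGeometry.CurveClass ℂ := fun N p => C N (fun k => p.1 + (ℓ : ℂ) * S N p.2 k); let E : Set (Literature.Probability.RandomPlanarGeometry.CurveClass ℂ) := {c | c ∈ Literature.Probability.RandomPlanarGeometry.CurveClass.simple ∧ c.range ⊆ closure Ω ∧ c.target ∈ Metric.ball y ℓ}; let W : MeasureTheory.Measure (Literature.Probability.RandomPlanarGeometry.CurveClass ℂ) := MeasureTheory.Measure.sum fun N : ℕ => ENNReal.ofReal ((μ⁻¹ / (2 * Real.pi)) ^ N) • ((((MeasureTheory.volume.restrict (Metric.ball x ℓ)).prod (MeasureTheory.volume.restrict (Set.univ.pi fun _ : Fin N => Set.Ico (0 : ℝ) (2 * Real.pi)))).restrict (V N ⁻¹' E)).map (V N)); (W Set.univ)⁻¹ • W); ∀ D : Literature.Probability.RandomPlanarGeometry.DobrushinDomain, ∃ a' b' : ℝ → ℂ, (Filter.Tendsto a' (nhdsWithin 0 (Set.Ioi 0)) (nhds (D.pt 0)) ∧ Filter.Tendsto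 b' (nhdsWithin 0 (Set.Ioi 0)) (nhds (D.pt 1)) ∧ ∀ᶠ ℓ in nhdsWithin 0 (Set.Ioi 0), MeasureTheory.IsProbabilityMeasure (fjc ℓ D.carrier (a' ℓ) (b' ℓ)))

/-- item stmt-CriticalPhenomena-8230 · support · rank 9 · open · by planner
[support] (route-repair 2026-08-15; replaces the guarded shared item LSWRestrictionFact =
stmt-CriticalPhenomena-0775 in this route) Lawler–Schramm–Werner 2003, Conformal restriction: the
chordal case (arXiv:math/0209343), p. 5 result 2 with Prop. 3.3, Thm 6.1, Cor. 8.6, transposed to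
chordal curve families on Dobrushin domains: a chordal family that is conformally covariant
(ChordalFamily.IsConformallyCovariant, inlined), has the two-sided restriction property
(ChordalFamily.IsRestriction, inlined) and is carried by simple curves meeting ∂D only at the marked
points is, in every Dobrushin domain, the chordal SLE_{8/3} law (IsSLELaw (8/3)). VERBATIM the
Literature named fact `Literature.Probability.RandomPlanarGeometry.LawlerSchrammWerner2003`
(ConformalRestriction.lean), PROVED in the tree: `LawlerSchrammWerner2003_holds`
(ConformalRestrictionHolds.lean; axioms propext/Classical.choice/Quot.sound) — closes in one line
`LawlerSchrammWerner2003_holds` after `import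
Literature.Probability.RandomPlanarGeometry.ConformalRestrictionHolds`. Unlike 0775 it carries no
`exists_isSLECurve →` guard (that all-κ fact is in-tree equivalent to the open SLE₈ trace theorem),
so the Assembly can con -/
@[route_item "route-CriticalPhenomena-SAWIsotropicAnchor", crux]
def LSW2003Characterisation : Prop :=
  ∀ P : Literature.Probability.RandomPlanarGeometry.ChordalFamily, P.IsChordal → (∀ (D D' : Literature.Probability.RandomPlanarGeometry.DobrushinDomain) (g : Literature.Probability.RandomPlanarGeometry.ConformalEquiv D.carrier D'.carrier) (Φ : C(ℂ, ℂ)), g.HasBoundaryValue (D.pt 0) (D'.pt 0) → g.HasBoundaryValue (D.pt 1) (D'.pt 1) → Set.EqOn Φ g D.carrier → P D' = (P D).map (Literature.Probability.RandomPlanarGeometry.CurveClass.map Φ)) → (∀ (D D' : Literature.Probability.RandomPlanarGeometry.DobrushinDomain), D'.carrier ⊆ D.carrier → D'.pt 0 = D.pt 0 → D'.pt 1 = D.pt 1 → ∀ T : Set (Literature.Probability.RandomPlanarGeometry.CurveClass ℂ), MeasurableSet T → P D' T * P D (Literature.Probability.RandomPlanarGeometry.CurveClass.rangeSubset (closure D'.carrier))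 = P D (T ∩ Literature.Probability.RandomPlanarGeometry.CurveClass.rangeSubset (closure D'.carrier))) → (∀ D : Literature.Probability.RandomPlanarGeometry.DobrushinDomain, ∀ᵐ γ ∂(P D), γ ∈ Literature.Probability.RandomPlanarGeometry.CurveClass.simple ∧ γ.range ∩ frontier D.carrier ⊆ {D.pt 0, D.pt 1}) → ∀ D : Literature.Probability.RandomPlanarGeometry.DobrushinDomain, Literature.Probability.RandomPlanarGeometry.IsSLELaw ((8 : NNReal) / 3) D (P D)

-- earlier Assembly (stmt-CriticalPhenomena-7302, replaced 2026-08-15T16:13:04Z -> stmt-CriticalPhenomena-10365): retired by None — Literature.Probability.RandomPlanarGeometry.exists_isSLECurve → Literature.Probability.RandomPlanarGeometry.IsSLECurve.map_eq → LSWRestrictionFact → RStarRot → AnchorLimitExists → AnchorAxiomsOfLimit → AnchorApproxExists → DirectionLawUniversality → SAWScalingLimit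
/-- item stmt-CriticalPhenomena-10365 · assembly · rank 1 · open · by planner
sources: LawlerSchrammWerner2003Restriction, LawlerSchrammWerner2004SAW
[assembly] AnchorLimitExists → RStarRot → AnchorAxiomsOfLimit → DirectionLawUniversality →
AnchorApproxExists → LSW2003Characterisation → SAWScalingLimit — exactly the type of the deciding
theorem `closes` (proved, rev 1): no exists_isSLECurve / IsSLECurve.map_eq / LSWRestrictionFact
guard, the SLE_{8/3} curve is read off IsSLELaw (8/3) D (P D) given by LSW2003Characterisation.
Closes in one line: `theorem Assembly_holds : Assembly := closes`. -/
@[route_item "route-CriticalPhenomena-SAWIsotropicAnchor"]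
def Assembly : Prop :=
  AnchorLimitExists → RStarRot → AnchorAxiomsOfLimit → DirectionLawUniversality → AnchorApproxExists → LSW2003Characterisation → _root_.SAWScalingLimit

/-! D-0027 §2.1 — DECIDING THEOREM (planner-authored via `route open/edit --closes-file`; by planner-rbadge-CriticalPhenomena-SAWIsotropicA-e213f66a-g4-0 2026-08-15T16:12:21Z):
its hypotheses are this route's items and its conclusion the sub-problem Statement (glue_lint), and it elaborates with this file. -/

@[closes "route-CriticalPhenomena-SAWIsotropicAnchor"] theorem closes (h₁ : AnchorLimitExists) (h₂ : RStarRot) (h₃ : AnchorAxiomsOfLimit)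
    (h₄ : DirectionLawUniversality) (h₆ : AnchorApproxExists) (h₇ : LSW2003Characterisation) :
    _root_.SAWScalingLimit := by
  intro D a b hab
  -- the full scaling limit `P` of the critical freely-jointed chain (AnchorLimitExists)
  obtain ⟨P, hPch, hconv⟩ := h₁
  -- its axioms (AnchorAxiomsOfLimit, using AnchorApproxExists so that no value `P D` is unconstrained)
  obtain ⟨hRM, hRev, hSim, hConj, hSimple⟩ := h₃ P hPch h₆ hconv
  -- rotation-invariant restriction–Markov rigidity (RStarRot): conformal covariance
  have hCC : P.IsConformallyCovariant := h₂ P hPch hRM hRev hSim hConj hSimple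
  -- Lawler–Schramm–Werner 2003 (LSW2003Characterisation): every `P D` is the chordal SLE_{8/3} law
  obtain ⟨Γ, hΓ, hlaw⟩ := h₇ P hPch hCC hRM.isRestriction hSimple D
  -- an admissible chain approximation of `D` (AnchorApproxExists)
  obtain ⟨a', b', happ⟩ := h₆ D
  refine ⟨Γ, hΓ, Filter.Eventually.of_forall fun δ =>
    Literature.Probability.RandomPlanarGeometry.SAW.aemeasurable_curve _ _ _ _, fun f => ?_⟩
  have hlim : ∫ ω, f (Γ ω) ∂Literature.Probability.Process.preWienerMeasure = ∫ x, f x ∂(P D) := by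
    rw [hlaw, MeasureTheory.integral_map hΓ.aemeasurable f.continuous.aestronglyMeasurable]
  rw [hlim]
  -- anchor convergence (AnchorLimitExists) + direction-law universality Haar ↔ ℤ/4 (DirectionLawUniversality)
  have key := (h₄ D a b a' b' hab happ f).add (hconv D a' b' happ f)
  rw [zero_add] at key
  exact key.congr fun δ => sub_add_cancel _ _

end Summit.CriticalPhenomena.SAWScalingLimit.Theses.SAWIsotropicAnchor
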